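import Literature.Barriers.QuantumAdvantage.FortnowRogersOracle
import Literature.Computability.Complexity.CohenGenericPneNP
import Literature.Computability.Complexity.OracleAbsorb
import HarnessLib

/-!
# `P^{B ⊕ G} ≠ NP^{B ⊕ G}` for every base oracle `B` and every Cohen generic `G`: level `k = 0` of `isInfinitePHRel_join_generic`, proved by rerelativization

Support file of the tenure of the barrier fact
`Literature.Barriers.QuantumAdvantage.fortnowRogers1999_cor37` (`SupremacyTheoremsNonRelativizing.lean`),
companion of `FortnowRogersOracle.lean`, whose named leaf `isInfinitePHRel_join_generic` asserts:
for every base oracle `B` there is a countable family `𝒮` of sets of Cohen conditions such that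
for every `𝒮`-generic `G` the polynomial-time hierarchy relative to `B ⊕ G` is infinite,
`∀ k, Σₖ^{B ⊕ G} ≠ Σₖ₊₁^{B ⊕ G}` ("the polynomial-time hierarchy is infinite relative to generic
oracles", Fortnow–Rogers 1999, §3, joined with a `PSPACE`-complete `H`; "any Cohen generic oracle
must also separate the polynomial hierarchy", Fenner–Fortnow–Kurtz–Li 2003, §1 p. 3). This file
PROVES its level `k = 0`,

* `cohenGeneric_join_sigmaPRel_zero_ne_one` — `∀ B, ∃ 𝒮 countable, ∀ G, IsGeneric 𝒮 G →
  Σ₀^{B ⊕ G} ≠ Σ₁^{B ⊕ G}` (i.e. `P^{B ⊕ G} ≠ NP^{B ⊕ G}`, `cohenGeneric_join_PRel_ne_NPRel`),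

by **rerelativizing** the tree's unjoined theorem "every Cohen generic separates `P` from `NP`"
(`Literature.Computability.Complexity.PRel_ne_NPRel_of_isGeneric`, `CohenGenericPneNP.lean`)
exactly as the toolkit prescribes (Fenner–Fortnow–Kurtz–Li §3.2 p. 14: genericity relative to `B`;
p. 34: "If our oracle construction is relativizable (and it always is), then this assumption costs
us nothing, since it can be discharged by rerelativization"): a polynomial-time machine with
oracle `B ⊕ G` is, at the level of runs, a machine querying `G` alone with `B` hard-wired — the
absorbed machine `OracleAlg.absorb` of `Complexity/OracleAbsorb.lean` for the view `joinView B`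
(`absorbedOracle_joinView`, `OracleAlg.run_absorb`). The density theorem
`BGS.isDense_forces_diagReq` of `CohenGenericPneNP.lean` holds for EVERY (machine, polynomial)
pair, computable or not, so the Baker–Gill–Solovay requirements of the absorbed machines are met
by finite extension; they are countably many (`joinDiagFamily_countable`), and a generic `G` for
them has `U_G ∉ P^{B ⊕ G}` (`U_not_mem_PRel_join_of_isGeneric`) while `U_G ∈ NP^{B ⊕ G}`
(`U_mem_NPRel_join`, through `G ≤ₚ B ⊕ G` by `w ↦ 1w`). The same absorption will let the
forcing arguments for the higher levels ignore the base oracle.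

Also proved on the way: `co_PRel` (`co P^O = P^O`, from the tree's `compl_mem_PRel`) and
`SigmaPRel_one` (`Σ₁^O = NP^O`, the relativized `SigmaP_one`).

## References

* [FortnowRogers1999JCSS] §3, proof of Cor. 3.7 (arXiv numbering, p. 5), read.
* [FennerFortnowKurtzLi2003IC] §1 p. 3, §3.2 p. 14, p. 34, read via
  `lit read doi:10.1016/s0890-5401(03)00018-x`.
* [AroraBarakCC2009] Thm. 3.7 (proof) for the diagonalization, Def. 5.3 for `Σ₁ = NP`.
-/

noncomputable section

namespace Literature.Barriers.QuantumAdvantage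

open _root_.Computability Literature.Computability.Complexity Literature.Computability.Complexity.Classes
  Literature.Computability.Complexity.CohenCondition Polynomial

/-! ### The view absorbing the base oracle of a join -/

/-- The view of the join `B ⊕ G` that hard-wires `B`: the empty query is answered "no", a query
`0w` is answered `[w ∈ B]`, a query `1w` is forwarded to the outer oracle as `w`.
[cite: FennerFortnowKurtzLi2003IC, §3.2 p. 14] -/
def joinView (B : Language Bool) : List Bool → List Bool ⊕ List Bool
  | [] => Sum.inl (encodeBool false)
  | false :: w => Sum.inl (Oracle.ofLanguage B w)
  | true :: w => Sum.inr w

/-- Indicator bits agree along an equivalence of memberships. [folklore] -/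
theorem boolIndicator_eq_of_iff {α γ : Type} {A : Set α} {C : Set γ} {a : α} {c : γ}
    (h : a ∈ A ↔ c ∈ C) : A.boolIndicator a = C.boolIndicator c := by
  rcases Bool.eq_false_or_eq_true (C.boolIndicator c) with h' | h'
  · rw [h']
    exact (Set.mem_iff_boolIndicator _ _).1 (h.2 ((Set.mem_iff_boolIndicator _ _).2 h'))
  · rw [h']
    exact (Set.notMem_iff_boolIndicator _ _).1 fun ha => (Set.notMem_iff_boolIndicator _ _).2 h' (h.1 ha)

/-- **Absorbing `B` presents `B ⊕ G`**: the oracle seen by a machine under the view `joinView B`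
with outer oracle `G` is the language oracle of the join `B ⊕ G`. [cite: FennerFortnowKurtzLi2003IC, §3.2 p. 14 ("tantamount to relativizing once to the oracle R ⊕ G")] -/
theorem absorbedOracle_joinView (B G : Language Bool) :
    OracleAlg.absorbedOracle (joinView B) (Oracle.ofLanguage G) = Oracle.ofLanguage (oracleJoin B G) := by
  funext y
  rcases y with _ | ⟨b, w⟩
  · rw [OracleAlg.absorbedOracle_of_inl (show joinView B [] = _ from rfl), Oracle.ofLanguage_apply,
      (Set.notMem_iff_boolIndicator _ _).1 nil_not_mem_oracleJoin]
  · cases b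
    · rw [OracleAlg.absorbedOracle_of_inl (show joinView B (false :: w) = _ from rfl),
        Oracle.ofLanguage_apply, Oracle.ofLanguage_apply,
        boolIndicator_eq_of_iff (false_cons_mem_oracleJoin (A := B) (B := G)).symm]
    · rw [OracleAlg.absorbedOracle_of_inr (show joinView B (true :: w) = _ from rfl),
        Oracle.ofLanguage_apply, Oracle.ofLanguage_apply,
        boolIndicator_eq_of_iff (true_cons_mem_oracleJoin (A := B) (B := G)).symm]

/-! ### The requirements of the absorbed machines -/

/-- The family of Baker–Gill–Solovay forcing sets of the absorbed machines `M.absorb (joinView B) q`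
over all polynomial-time pairs `(M, q)` (replay fuel `q(|x|)`, the round budget).
[cite: FennerFortnowKurtzLi2003IC, §1 p. 3 and §3.2 p. 14] -/
def joinDiagFamily (B : Language Bool) : Set (Set CohenCondition) :=
  (fun D : OracleAlg Bool × Polynomial ℕ =>
      {σ : CohenCondition |
        σ.Forces (BGS.DiagReq (D.1.absorb (joinView B) fun x => D.2.eval x.length, D.2))}) ''
    {D | D.1.IsPolyTime encodingBoolBool}

/-- The family is countable (machines as strings). [cite: AroraBarakCC2009, §1.4] -/
theorem joinDiagFamily_countable (B : Language Bool) : (joinDiagFamily B).Countable := by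
  obtain ⟨e, he⟩ := BGS.exists_enum_pair
  exact ((Set.countable_range e).mono he).image _

/-- Every member of the family is dense (the density theorem of `CohenGenericPneNP.lean` needs no
computability of the machine). [cite: AroraBarakCC2009, Thm. 3.7 (proof)] -/
theorem isDense_of_mem_joinDiagFamily {B : Language Bool} {S : Set CohenCondition}
    (hS : S ∈ joinDiagFamily B) : IsDense S := by
  obtain ⟨D, -, rfl⟩ := hS
  exact BGS.isDense_forces_diagReq _

/-- **`U_G ∉ P^{B ⊕ G}` for a generic `G`**: a polynomial-time machine deciding `U_G` with oracle
`B ⊕ G` within `q(|x|)` rounds would, absorbed (`OracleAlg.run_absorb` with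
`absorbedOracle_joinView`), decide it with oracle `G` within the same budget, against the forced
requirement. [cite: FennerFortnowKurtzLi2003IC, §3.2 p. 14 and p. 34] [cite: AroraBarakCC2009, Thm. 3.7] -/
theorem U_not_mem_PRel_join_of_isGeneric {B G : Language Bool} (hG : IsGeneric (joinDiagFamily B) G) :
    BGS.U G ∉ PRel (Oracle.ofLanguage (oracleJoin B G)) := by
  rintro ⟨M, hM, q, hq⟩
  have hR : BGS.DiagReq (M.absorb (joinView B) fun x => q.eval x.length, q) G :=
    hG.of_forces_of_mem ⟨(M, q), hM, rfl⟩ (BGS.isDense_forces_diagReq _) fun _ h => h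
  obtain ⟨x, hx⟩ := hR
  refine hx ?_
  have h1 := (hq x).1
  rw [← absorbedOracle_joinView] at h1
  exact OracleAlg.run_absorb M (joinView B) (Oracle.ofLanguage G) x le_rfl h1

/-- `G ∈ P^{B ⊕ G}`: `G ≤ₚ B ⊕ G` by `w ↦ 1w` (`cons_mem_FP`), and `P^{B ⊕ G}` is closed under Karp
reductions and contains `B ⊕ G`. [cite: AaronsonChen2017, §5 (p. 20)] -/
theorem self_mem_PRel_join (B G : Language Bool) : G ∈ PRel (Oracle.ofLanguage (oracleJoin B G)) :=
  mem_PRel_of_karpReducible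
    ⟨List.cons true, cons_mem_FP true, fun _ => (true_cons_mem_oracleJoin (A := B) (B := G)).symm⟩
    (self_mem_PRel_ofLanguage_holds _)

/-- `U_G ∈ NP^{B ⊕ G}`: witness `y`, verifier `G ∈ P^{B ⊕ G}`, bound `X`.
[cite: AroraBarakCC2009, Thm. 3.7 (proof: "U_B is clearly in NP^B")] -/
theorem U_mem_NPRel_join (B G : Language Bool) : BGS.U G ∈ NPRel (Oracle.ofLanguage (oracleJoin B G)) :=
  ⟨G, self_mem_PRel_join B G, X, fun x => by rw [eval_X]; exact Iff.rfl⟩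

/-- **`P^{B ⊕ G} ≠ NP^{B ⊕ G}` for every `joinDiagFamily B`-generic `G`.**
[cite: FennerFortnowKurtzLi2003IC, §1 p. 3 and §3.2 p. 14] [cite: FortnowRogers1999JCSS, §3, proof of Cor. 3.7 (arXiv numbering)] -/
theorem PRel_ne_NPRel_join_of_isGeneric {B G : Language Bool} (hG : IsGeneric (joinDiagFamily B) G) :
    PRel (Oracle.ofLanguage (oracleJoin B G)) ≠ NPRel (Oracle.ofLanguage (oracleJoin B G)) := fun heq =>
  U_not_mem_PRel_join_of_isGeneric hG (heq ▸ U_mem_NPRel_join B G)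

/-! ### `Σ₀ ≠ Σ₁` relative to `B ⊕ G` -/

/-- `co P^O = P^O` (`P^O` is closed under complement, `compl_mem_PRel`). [folklore] -/
theorem co_PRel (O : Oracle) : co (PRel O) = PRel O := by
  ext L
  refine ⟨fun h => ?_, fun h => compl_mem_PRel h⟩
  have h' : Lᶜᶜ ∈ PRel O := compl_mem_PRel h
  rwa [compl_compl] at h'

/-- `Σ₁^O = NP^O` (`Σ₁ = ∃ᵖ·coΣ₀ = ∃ᵖ·P^O`), the relativized `SigmaP_one`. [cite: AroraBarakCC2009, Def. 5.3] -/
theorem SigmaPRel_one (O : Oracle) : SigmaPRel O 1 = NPRel O := by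
  change polyExists (co (PRel O)) = polyExists (PRel O)
  rw [co_PRel]

/-- `Σ₀^{B ⊕ G} ≠ Σ₁^{B ⊕ G}` for every `joinDiagFamily B`-generic `G`. [cite: FortnowRogers1999JCSS, §3, proof of Cor. 3.7 (arXiv numbering)] -/
theorem sigmaPRel_zero_ne_one_join_of_isGeneric {B G : Language Bool} (hG : IsGeneric (joinDiagFamily B) G) :
    SigmaPRel (Oracle.ofLanguage (oracleJoin B G)) 0 ≠ SigmaPRel (Oracle.ofLanguage (oracleJoin B G)) 1 := by
  rw [SigmaPRel_one]
  exact PRel_ne_NPRel_join_of_isGeneric hG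

/-- **Level `k = 0` of `isInfinitePHRel_join_generic`, `P` vs `NP` form**: for every base oracle `B`
there is a countable family of sets of Cohen conditions every generic oracle `G` for which has
`P^{B ⊕ G} ≠ NP^{B ⊕ G}`. [cite: FennerFortnowKurtzLi2003IC, §1 p. 3 and §3.2 p. 14] -/
theorem cohenGeneric_join_PRel_ne_NPRel (B : Language Bool) :
    ∃ 𝒮 : Set (Set CohenCondition), 𝒮.Countable ∧ ∀ G : Language Bool, IsGeneric 𝒮 G →
      PRel (Oracle.ofLanguage (oracleJoin B G)) ≠ NPRel (Oracle.ofLanguage (oracleJoin B G)) :=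
  ⟨joinDiagFamily B, joinDiagFamily_countable B, fun _ hG => PRel_ne_NPRel_join_of_isGeneric hG⟩

/-- **Level `k = 0` of `isInfinitePHRel_join_generic`** (`FortnowRogersOracle.lean`), proved: for every
base oracle `B` there is a countable family `𝒮` with `Σ₀^{B ⊕ G} ≠ Σ₁^{B ⊕ G}` for every
`𝒮`-generic `G`. [cite: FortnowRogers1999JCSS, §3, proof of Cor. 3.7 (arXiv numbering)] [cite: FennerFortnowKurtzLi2003IC, §1 p. 3] -/
theorem cohenGeneric_join_sigmaPRel_zero_ne_one (B : Language Bool) :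
    ∃ 𝒮 : Set (Set CohenCondition), 𝒮.Countable ∧ ∀ G : Language Bool, IsGeneric 𝒮 G →
      SigmaPRel (Oracle.ofLanguage (oracleJoin B G)) 0 ≠ SigmaPRel (Oracle.ofLanguage (oracleJoin B G)) 1 :=
  ⟨joinDiagFamily B, joinDiagFamily_countable B, fun _ hG => sigmaPRel_zero_ne_one_join_of_isGeneric hG⟩

/-- Such `G` exist through every condition, for every `B` (existence of generics). [cite: FennerFortnowKurtzLi2003IC, Lemma 3.12 (p. 11)] -/
theorem exists_extendedBy_PRel_ne_NPRel_join (B : Language Bool) (σ₀ : CohenCondition) :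
    ∃ G : Language Bool, σ₀.ExtendedBy G ∧
      PRel (Oracle.ofLanguage (oracleJoin B G)) ≠ NPRel (Oracle.ofLanguage (oracleJoin B G)) := by
  obtain ⟨G, hσ₀, hG⟩ := exists_extendedBy_isGeneric (joinDiagFamily_countable B) σ₀
  exact ⟨G, hσ₀, PRel_ne_NPRel_join_of_isGeneric hG⟩

end Literature.Barriers.QuantumAdvantage

end
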